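import Literature.NumberTheory.EllipticCurves.KummerMap
import Literature.NumberTheory.EllipticCurves.BSDRankZeroDensity
import HarnessLib

/-!
# Route `GenusKolyvaginAtTwo`, LINE 18 (L_T `PowDvdShaCardAtTwoRT`, stmt-BirchSwinnertonDyer-23242), stub L
# `stub_twinShaLaddersAtTwo` — THE DESCENT LAYER (3/3): the Kummer-kernel condition of the descent from McCallum's
# avoidance of the Mordell–Weil class `c_L(1)`

Seat `bsd-line-gk2-p2` g18 (PROVER seat 2/3, cell `bsd-f1-sign2`), `--supports stmt-BirchSwinnertonDyer-23242` (helper; closes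
nothing). THEOREMS ONLY (no definition, no named fact, no `sorry`); BSD is not proved by any of this.

WHY. The descent files `…RTRungDescent` / `…RTRungDescentTwin` turn a family of `τ`-eigen Selmer classes `z_i ∈ H¹(K, E_K[2^L])`
into a rung of L's ℚ-side ladders PROVIDED the span of `z` meets the Kummer kernel `ker(ι : H¹(K, E_K[2^L]) → H¹(K, E_K)) =
δ(E(K)/2^L)` trivially (binder `hker`). McCallum's Prop. 5.2 / Thm. 5.4 supplies instead «`⟨c_M(n)⟩ ∩ C = 0`» for a subgroup
`C ∋ c_M(1)`, and `c_L(1) = δ(P_1) = δ(y_K)` is only a MULTIPLE `2^{M₀}·δ(g)` of the Kummer class of a generator `g` of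
`E(K)/torsion` (rank one, odd torsion on the habitat). The gap closes by the structure of cyclic `2`-groups: every non-zero
subgroup of `⟨δ(g)⟩` contains its socle `2^{k−1}δ(g)`, which also lies in `⟨c_L(1)⟩` as soon as `c_L(1) ≠ 0` (`L > M₀`); so a span
disjoint from `⟨c_L(1)⟩` is disjoint from the whole Kummer line. Pure algebra + the tree's Kummer sequence
(`mem_range_kummerMapTorsion_of_torsionH1ToH1_eq_zero`, `kummerMapTorsion_ker`):

* §1 `exists_two_pow_smul_eq_socle`, `disjoint_zmultiples_of_disjoint_zmultiples_of_mem` — in any additive group: if `κ` has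
  order `2^k`, `c ∈ ⟨κ⟩`, `c ≠ 0`, then a subgroup disjoint from `⟨c⟩` is disjoint from `⟨κ⟩`;
  `sum_zsmul_eq_zero_of_map_eq_zero` — hence the `hker` binder: if `ker f ≤ ⟨κ⟩` and the span of `z` is disjoint from `⟨c⟩`, then
  `f (∑ e_i z_i) = 0 ⟹ ∑ e_i z_i = 0`.
* §2 `kummerMapTorsion_eq_zsmul_of_congr`, `mem_zmultiples_kummer_of_torsionH1ToH1_eq_zero` — for `E/F` (any number field) and
  a point `g` generating `E(F)` modulo `n` (`∀ P, ∃ k Q, n•Q = P − k•g`): `ker ι ≤ ⟨δ(g)⟩`;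
  **`sum_zsmul_eq_zero_of_torsionH1ToH1_eq_zero_of_disjoint_kummer`** — the `hker` binder of the two descent files from
  «span ∩ ⟨δ(P₀)⟩ = 0» for ANY `P₀ ∈ E(F)` with `n•Q ≠ P₀` for all `Q` (at `n = 2^L`, `P₀ = P_1 = y_K`: `L > M₀`), i.e. from
  McCallum's avoidance of `c_L(1) = δ(P_1)` (tree: `kolyvaginClass_toGeomPoints`, `KolyvaginBottom.toGeomPoints_map_algebraMap`).

References: [McCallumLMS1991] §5 Prop. 5.2 («`⟨c_M(n)⟩ ∩ C = 0`»), Thm. 5.4 (p. 310); [GrossLMS1991] §4 (P_1 = y_K), §5;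
[SilvermanAEC2009] VIII.§2 (Kummer sequence), X.§4.
-/

set_option autoImplicit false
-- the Theorems namespace of this sub repeats the summit name by design (D-0017 nested layout)
set_option linter.dupNamespace false

noncomputable section

open scoped Classical

namespace Summit.BirchSwinnertonDyer.BirchSwinnertonDyer.Theorems.GenusExact.PlusDescent

open WeierstrassCurve Literature.NumberTheory.EllipticCurves AddSubgroup

/-! ## §1 Cyclic `2`-groups: a subgroup disjoint from a non-zero subgroup of `⟨κ⟩` is disjoint from `⟨κ⟩` -/

section Cyclic

variable {A B : Type*} [AddCommGroup A] [AddCommGroup B]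

/-- In `⟨κ⟩` with `ord κ = 2^k`, every non-zero element has a `2`-power multiple equal to the socle generator `2^{k−1} • κ`
(the unique element of order `2`). [folklore] -/
theorem exists_two_pow_smul_eq_socle {κ x : A} {k : ℕ} (hκ : addOrderOf κ = 2 ^ k) (hx : x ∈ zmultiples κ) (hx0 : x ≠ 0) :
    ∃ j : ℕ, 2 ^ j • x = 2 ^ (k - 1) • κ := by
  -- `k ≥ 1`
  have hk : k ≠ 0 := by
    rintro rfl
    rw [pow_zero, AddMonoid.addOrderOf_eq_one_iff] at hκ
    rw [hκ, AddSubgroup.zmultiples_zero_eq_bot, AddSubgroup.mem_bot] at hx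
    exact hx0 hx
  have h2k : (2 : ℕ) ^ k = 2 * 2 ^ (k - 1) := by
    rw [← pow_succ', Nat.sub_add_cancel (Nat.pos_of_ne_zero hk)]
  -- the order of `x` is `2^i`, `i ≥ 1`
  have hxdvd : addOrderOf x ∣ 2 ^ k := hκ ▸ addOrderOf_dvd_of_mem_zmultiples hx
  obtain ⟨i, -, hi⟩ := (Nat.dvd_prime_pow Nat.prime_two).mp hxdvd
  have hi0 : i ≠ 0 := by
    rintro rfl
    rw [pow_zero, AddMonoid.addOrderOf_eq_one_iff] at hi
    exact hx0 hi
  -- `y := 2^(i-1) • x` is killed by `2` and non-zero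
  set y := 2 ^ (i - 1) • x with hy
  have hy2 : (2 : ℤ) • y = 0 := by
    rw [hy, ← natCast_zsmul, smul_smul]
    have : ((2 : ℤ) * ((2 ^ (i - 1) : ℕ) : ℤ)) = ((2 ^ i : ℕ) : ℤ) := by
      rw [← Nat.sub_add_cancel (Nat.pos_of_ne_zero hi0), pow_succ']
      push_cast
      ring
    rw [this, natCast_zsmul, ← hi, addOrderOf_nsmul_eq_zero]
  have hy0 : y ≠ 0 := by
    intro h
    have hdvd : addOrderOf x ∣ 2 ^ (i - 1) := addOrderOf_dvd_iff_nsmul_eq_zero.mpr h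
    rw [hi, Nat.pow_dvd_pow_iff_le_right (by norm_num)] at hdvd
    omega
  -- `y = m • κ` with `2^k ∣ 2m`, so `m = 2^(k-1) t`
  obtain ⟨m, hm⟩ := mem_zmultiples_iff.mp ((zmultiples κ).nsmul_mem hx (2 ^ (i - 1)))
  have hm2 : ((2 ^ k : ℕ) : ℤ) ∣ 2 * m := by
    rw [← hκ, addOrderOf_dvd_iff_zsmul_eq_zero, mul_smul, hm, ← hy]
    exact hy2
  rw [h2k, Nat.cast_mul, Nat.cast_ofNat, mul_dvd_mul_iff_left (two_ne_zero)] at hm2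
  obtain ⟨t, rfl⟩ := hm2
  -- `2 • (2^(k-1) • κ) = 0`
  have hsoc2 : (2 : ℤ) • (((2 ^ (k - 1) : ℕ) : ℤ) • κ) = 0 := by
    rw [smul_smul, ← Nat.cast_ofNat, ← Nat.cast_mul, ← h2k, natCast_zsmul, ← hκ, addOrderOf_nsmul_eq_zero]
  rcases Int.even_or_odd t with ⟨r, rfl⟩ | ⟨r, rfl⟩
  · -- `t` even: `y = 0`, contradiction
    exfalso
    apply hy0
    rw [hy, ← hm, show ((2 ^ (k - 1) : ℕ) : ℤ) * (r + r) = r * (2 * ((2 ^ (k - 1) : ℕ) : ℤ)) by ring, mul_smul,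
      mul_smul, hsoc2, smul_zero]
  · refine ⟨i - 1, ?_⟩
    rw [← hm, ← natCast_zsmul κ (2 ^ (k - 1)),
      show ((2 ^ (k - 1) : ℕ) : ℤ) * (2 * r + 1) = r * (2 * ((2 ^ (k - 1) : ℕ) : ℤ)) + ((2 ^ (k - 1) : ℕ) : ℤ) by ring,
      add_smul, mul_smul, mul_smul, hsoc2, smul_zero, zero_add]

/-- **A subgroup disjoint from a non-zero subgroup `⟨c⟩ ≤ ⟨κ⟩` of a cyclic `2`-group `⟨κ⟩` is disjoint from `⟨κ⟩`** (both would
contain the socle). [folklore] -/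
theorem disjoint_zmultiples_of_disjoint_zmultiples_of_mem {κ c : A} {k : ℕ} (hκ : addOrderOf κ = 2 ^ k)
    (hc : c ∈ zmultiples κ) (hc0 : c ≠ 0) (S : AddSubgroup A) (hS : Disjoint S (zmultiples c)) :
    Disjoint S (zmultiples κ) := by
  rw [disjoint_def] at hS ⊢
  intro x hxS hxκ
  by_contra hx0
  obtain ⟨j, hj⟩ := exists_two_pow_smul_eq_socle hκ hxκ hx0
  obtain ⟨j', hj'⟩ := exists_two_pow_smul_eq_socle hκ hc hc0
  -- the socle lies in `S ⊓ ⟨c⟩ = ⊥`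
  have hsocS : 2 ^ (k - 1) • κ ∈ S := by rw [← hj]; exact S.nsmul_mem hxS _
  have hsocc : 2 ^ (k - 1) • κ ∈ zmultiples c := by rw [← hj']; exact (zmultiples c).nsmul_mem (mem_zmultiples c) _
  have hsoc0 : 2 ^ (k - 1) • κ = 0 := hS hsocS hsocc
  -- but `2^(k-1) • κ ≠ 0` since `ord κ = 2^k` with `k ≥ 1`
  have hk : k ≠ 0 := by
    rintro rfl
    rw [pow_zero, AddMonoid.addOrderOf_eq_one_iff] at hκ
    rw [hκ, AddSubgroup.zmultiples_zero_eq_bot, AddSubgroup.mem_bot] at hc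
    exact hc0 hc
  have hdvd : addOrderOf κ ∣ 2 ^ (k - 1) := addOrderOf_dvd_iff_nsmul_eq_zero.mpr hsoc0
  rw [hκ, Nat.pow_dvd_pow_iff_le_right (by norm_num)] at hdvd
  omega

/-- **The `hker` binder of the descent from avoidance of `⟨c⟩`.** If `ker f ≤ ⟨κ⟩` (`κ` of order `2^k`), `c ∈ ⟨κ⟩` is non-zero and
the span of a family `z` is disjoint from `⟨c⟩`, then `f (∑ e_i z_i) = 0 ⟹ ∑ e_i z_i = 0`. [cite: McCallumLMS1991, §5 Prop. 5.2] -/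
theorem sum_zsmul_eq_zero_of_map_eq_zero (f : A →+ B) {κ c : A} {k : ℕ} (hκ : addOrderOf κ = 2 ^ k)
    (hkerf : ∀ x, f x = 0 → x ∈ zmultiples κ) (hc : c ∈ zmultiples κ) (hc0 : c ≠ 0)
    {s : ℕ} (z : Fin s → A) (hdisj : Disjoint (AddSubgroup.closure (Set.range z)) (zmultiples c)) :
    ∀ e : Fin s → ℤ, f (∑ i, e i • z i) = 0 → ∑ i, e i • z i = 0 := by
  intro e he
  have hspan : ∑ i, e i • z i ∈ AddSubgroup.closure (Set.range z) :=
    sum_mem fun i _ ↦ zsmul_mem (AddSubgroup.subset_closure (Set.mem_range_self i)) _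
  exact (disjoint_def.mp (disjoint_zmultiples_of_disjoint_zmultiples_of_mem hκ hc hc0 _ hdisj)) hspan (hkerf _ he)

end Cyclic

/-! ## §2 The Kummer line of `E(F)`: `ker(H¹(F, E[n]) → H¹(F, E)) ≤ ⟨δ(g)⟩` and the `hker` binder from avoidance of `⟨δ(P₀)⟩` -/

section Kummer

universe u

variable {F : Type u} [Field F] [NumberField F] (V : WeierstrassCurve F) (n : ℤ)
  (hdiv : ∀ P : geomPoints V, ∃ Q : geomPoints V, n • Q = P)

/-- `P ≡ k•g (mod n E(F))` ⟹ `δ(P) = k • δ(g)` (`ker δ = nE(F)`). [cite: SilvermanAEC2009, VIII.§2] -/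
theorem kummerMapTorsion_eq_zsmul_of_congr {g P : V.toAffine.Point} {k : ℤ} {Q : V.toAffine.Point}
    (hQ : n • Q = P - k • g) :
    kummerMapTorsion V n hdiv P = k • kummerMapTorsion V n hdiv g := by
  have hker : P - k • g ∈ (kummerMapTorsion V n hdiv).ker := by
    rw [kummerMapTorsion_ker]
    exact ⟨Q, hQ⟩
  rw [AddMonoidHom.mem_ker, map_sub, map_zsmul, sub_eq_zero] at hker
  exact hker

/-- **`ker(H¹(F, E[n]) → H¹(F, E)) ≤ ⟨δ(g)⟩`** when `g` generates `E(F)` modulo `n` (e.g. `E(F) = ℤg ⊕ T` with `#T` prime to `n`):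
the kernel is the Kummer image (exactness), and `δ(P) = k•δ(g)` for `P ≡ k•g`. [cite: SilvermanAEC2009, VIII.§2] -/
theorem mem_zmultiples_kummer_of_torsionH1ToH1_eq_zero (g : V.toAffine.Point)
    (hg : ∀ P : V.toAffine.Point, ∃ (k : ℤ) (Q : V.toAffine.Point), n • Q = P - k • g)
    (x : galH1Torsion V n) (hx : torsionH1ToH1 V n x = 0) :
    x ∈ zmultiples (kummerMapTorsion V n hdiv g) := by
  obtain ⟨P, rfl⟩ := mem_range_kummerMapTorsion_of_torsionH1ToH1_eq_zero V n hdiv x hx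
  obtain ⟨k, Q, hQ⟩ := hg P
  rw [kummerMapTorsion_eq_zsmul_of_congr V n hdiv hQ]
  exact zsmul_mem (mem_zmultiples _) k

omit [NumberField F] in
/-- The order of a Kummer class at a `2`-power level is a power of `2`. [folklore] -/
theorem exists_addOrderOf_kummerMapTorsion_eq_two_pow {L : ℕ}
    (hdiv' : ∀ P : geomPoints V, ∃ Q : geomPoints V, ((2 ^ L : ℕ) : ℤ) • Q = P) (g : V.toAffine.Point) :
    ∃ k : ℕ, addOrderOf (kummerMapTorsion V ((2 ^ L : ℕ) : ℤ) hdiv' g) = 2 ^ k := by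
  have hkill : addOrderOf (kummerMapTorsion V ((2 ^ L : ℕ) : ℤ) hdiv' g) ∣ 2 ^ L := by
    apply addOrderOf_dvd_of_nsmul_eq_zero
    rw [← natCast_zsmul]
    exact zsmul_galH1Torsion_eq_zero V _ _
  obtain ⟨k, -, hk⟩ := (Nat.dvd_prime_pow Nat.prime_two).mp hkill
  exact ⟨k, hk⟩

/-- **THE `hker` BINDER OF THE DESCENT FROM McCALLUM'S AVOIDANCE OF `c_L(1)`.** `E/F` over a number field, level `2^L`, a point
`g` generating `E(F)` modulo `2^L`, and ANY `P₀ ∈ E(F)` with `2^L ∤ P₀` in `E(F)` (`P₀ = P_1 = y_K`: `L > M₀`). If the span of a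
family `z_i ∈ H¹(F, E[2^L])` is disjoint from `⟨δ(P₀)⟩` (McCallum: «`⟨c⟩ ∩ C = 0`», `C ∋ c_L(1) = δ(P_1)`), then
`ι(∑ e_i z_i) = 0 ⟹ ∑ e_i z_i = 0` for `ι : H¹(F, E[2^L]) → H¹(F, E)` — the hypothesis `hker` of
`exists_shaFamily_of_fixed_selmerFamily` / `exists_shaFamily_twin_of_antifixed_selmerFamily`.
[cite: McCallumLMS1991, §5 Prop. 5.2, Thm. 5.4 (p. 310)] [cite: GrossLMS1991, §4 (P_1 = y_K)] -/
theorem sum_zsmul_eq_zero_of_torsionH1ToH1_eq_zero_of_disjoint_kummer {L : ℕ}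
    (hdiv' : ∀ P : geomPoints V, ∃ Q : geomPoints V, ((2 ^ L : ℕ) : ℤ) • Q = P)
    (g : V.toAffine.Point)
    (hg : ∀ P : V.toAffine.Point, ∃ (k : ℤ) (Q : V.toAffine.Point), ((2 ^ L : ℕ) : ℤ) • Q = P - k • g)
    (P₀ : V.toAffine.Point) (hP₀ : ∀ Q : V.toAffine.Point, ((2 ^ L : ℕ) : ℤ) • Q ≠ P₀)
    {s : ℕ} (z : Fin s → galH1Torsion V ((2 ^ L : ℕ) : ℤ))
    (hdisj : Disjoint (AddSubgroup.closure (Set.range z)) (zmultiples (kummerMapTorsion V ((2 ^ L : ℕ) : ℤ) hdiv' P₀))) :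
    ∀ e : Fin s → ℤ, torsionH1ToH1 V ((2 ^ L : ℕ) : ℤ) (∑ i, e i • z i) = 0 → ∑ i, e i • z i = 0 := by
  obtain ⟨k, hk⟩ := exists_addOrderOf_kummerMapTorsion_eq_two_pow V hdiv' g
  -- `δ(P₀) ∈ ⟨δ(g)⟩`, non-zero
  obtain ⟨k₀, Q₀, hQ₀⟩ := hg P₀
  have hc : kummerMapTorsion V ((2 ^ L : ℕ) : ℤ) hdiv' P₀ ∈ zmultiples (kummerMapTorsion V ((2 ^ L : ℕ) : ℤ) hdiv' g) := by
    rw [kummerMapTorsion_eq_zsmul_of_congr V _ hdiv' hQ₀]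
    exact zsmul_mem (mem_zmultiples _) k₀
  have hc0 : kummerMapTorsion V ((2 ^ L : ℕ) : ℤ) hdiv' P₀ ≠ 0 := by
    intro h
    have hmem : P₀ ∈ (kummerMapTorsion V ((2 ^ L : ℕ) : ℤ) hdiv').ker := (AddMonoidHom.mem_ker).mpr h
    rw [kummerMapTorsion_ker] at hmem
    obtain ⟨Q, hQ⟩ := hmem
    exact hP₀ Q hQ
  exact sum_zsmul_eq_zero_of_map_eq_zero (torsionH1ToH1 V _) hk
    (mem_zmultiples_kummer_of_torsionH1ToH1_eq_zero V _ hdiv' g hg) hc hc0 z hdisj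

end Kummer

end Summit.BirchSwinnertonDyer.BirchSwinnertonDyer.Theorems.GenusExact.PlusDescent

end
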